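import Literature.Analysis.ODE.LinearComparison
import Mathlib.Analysis.Calculus.Deriv.Inv
import HarnessLib

/-!
# Tao's cascade ODE, §6.7: averaging over the fast rotor (`∫ a₀` during the energy drain)

T. Tao, *Finite time blowup for an averaged three-dimensional Navier–Stokes equation*,
J. Amer. Math. Soc. **29** (2016), 601–674 = arXiv:1402.0290v3, §6.7, proof of Prop. 6.17 ("No exit
to coarse scales"). There the modified energy `E* = Ẽ₋₁ - ½(1+ε₀)^{5/2}K a₋₁d₋₁ (ε²/c₋₁) a₀` obeys
`∂ₜE* ≤ -½K (a₋₁²+d₋₁²) a₀ + O(K^{-14})`, and the source concludes "by Gronwall's inequality, it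
thus suffices to show that `∫₀ᵗ a₀ ≳ 1`". Grönwall with the *signed* rate `-K a₀(t)` in fact
requires `inf_{s ≤ t} ∫ₛᵗ a₀ ≥ -O(1/K)`, and on `[t_c, τ₁]` the mode `a₀` oscillates in sign: by
(6.129)/(6.132) the pair `(a₀, d₀)` rotates with angular speed `ε⁻² c₀ ≥ K^{100}` on
`I = [t_c + K⁻⁹, τ₁]` ((6.165)). The missing ingredient is the elementary averaging estimate proved
in this file: from the `d₀`-equation (6.132) `∂ₜd₀ = ε⁻²c₀a₀ - (1+ε₀)^{5/2}K d₀a₁ + O(δ)` one has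
`a₀ = (∂ₜd₀ + (1+ε₀)^{5/2}K d₀ a₁ - O(δ)) · ε²/c₀`, and integrating by parts against the slowly
varying weight `ε²/c₀` (`|∂ₜc₀| ≲ K^{10} c₀`, (6.181)) gives
`|∫ₛᵗ a₀| ≤ (2M + (ML + κM² + η)(t-s)) / (ρ c_min)` (`integral_rotor_le`), which is `≤ K⁻⁹` on `I`
(`ρ c_min = K^{20}` once `c₀ ≥ K^{20}ε²`). The statement is a stand-alone real-variable theorem with
free parameters, in the conventions of `Literature/Analysis/ODE/LinearComparison.lean`.

## References

* T. Tao, J. Amer. Math. Soc. 29 (2016), 601–674, arXiv:1402.0290v3, §6.6 (6.132), §6.7 (6.165),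
  (6.181), proof of Prop. 6.17. [`Tao2016AveragedNS`]
-/

noncomputable section

open Set MeasureTheory intervalIntegral Filter Topology

namespace Literature.Analysis.FluidPDE

namespace TaoCascade

open Literature.Analysis.ODE

/-- **Averaging over the fast rotor.** Let `d₀, c₀` be `C¹` on `[τ₀, +∞)` and `a₀` continuous on
`[s, t]` (`τ₀ ≤ s ≤ t`), with `c₀ ≥ c_min > 0`, `|∂ₜc₀| ≤ L c₀`, `|d₀|, |a₁| ≤ M` on `[s, t]`, and
the `d₀`-equation (6.132) in the form `|∂ₜd₀ - (ρ c₀ a₀ - κ d₀ a₁)| ≤ η` with `ρ > 0`. Then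
`|∫ₛᵗ a₀| ≤ (2M + (ML + |κ|M² + η)(t - s)) / (ρ c_min)`: writing
`a₀ = ∂ₜ(d₀/(ρc₀)) + d₀∂ₜc₀/(ρc₀²) + (κd₀a₁ - e₄)/(ρc₀)` and integrating the first term exactly.
[cite: Tao2016AveragedNS, §6.7 proof of Prop. 6.17] -/
theorem integral_rotor_le {τ₀ s t : ℝ} {a₀ d₀ c₀ a₁ : ℝ → ℝ} {ρ κ η L M c_min : ℝ}
    (hd₀ : ContDiffOn ℝ 1 d₀ (Ici τ₀)) (hc₀ : ContDiffOn ℝ 1 c₀ (Ici τ₀))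
    (ha₀ : ContinuousOn a₀ (Icc s t)) (hτ : τ₀ ≤ s) (hst : s ≤ t)
    (hρ : 0 < ρ) (hcmin : 0 < c_min) (hc : ∀ u ∈ Icc s t, c_min ≤ c₀ u)
    (hc' : ∀ u ∈ Icc s t, |derivWithin c₀ (Ici τ₀) u| ≤ L * c₀ u)
    (hdM : ∀ u ∈ Icc s t, |d₀ u| ≤ M) (haM : ∀ u ∈ Icc s t, |a₁ u| ≤ M)
    (hD : ∀ u ∈ Icc s t,
      |derivWithin d₀ (Ici τ₀) u - (ρ * c₀ u * a₀ u - κ * d₀ u * a₁ u)| ≤ η) :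
    |∫ u in s..t, a₀ u| ≤ (2 * M + (M * L + |κ| * M ^ 2 + η) * (t - s)) / (ρ * c_min) := by
  have hM0 : 0 ≤ M := (abs_nonneg _).trans (hdM s ⟨le_rfl, hst⟩)
  have hL0 : 0 ≤ M * L + |κ| * M ^ 2 + η := by
    have h1 : 0 ≤ L * c₀ s := (abs_nonneg _).trans (hc' s ⟨le_rfl, hst⟩)
    have hcs : 0 < c₀ s := hcmin.trans_le (hc s ⟨le_rfl, hst⟩)
    have hL : 0 ≤ L := nonneg_of_mul_nonneg_left h1 hcs
    have hη : 0 ≤ η := (abs_nonneg _).trans (hD s ⟨le_rfl, hst⟩)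
    positivity
  have hcpos : ∀ u ∈ Icc s t, 0 < c₀ u := fun u hu => hcmin.trans_le (hc u hu)
  -- the weight `g = d₀ / (ρ c₀)` and its derivative
  set g : ℝ → ℝ := fun u => d₀ u / (ρ * c₀ u) with hg
  set d₀' : ℝ → ℝ := derivWithin d₀ (Ici τ₀) with hd₀'
  set c₀' : ℝ → ℝ := derivWithin c₀ (Ici τ₀) with hc₀'
  set g' : ℝ → ℝ := fun u => (d₀' u * (ρ * c₀ u) - d₀ u * (ρ * c₀' u)) / (ρ * c₀ u) ^ 2 with hg'
  have hd₀c : ContinuousOn d₀ (Icc s t) := continuousOn_Icc_of_contDiffOn hd₀ hτ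
  have hc₀c : ContinuousOn c₀ (Icc s t) := continuousOn_Icc_of_contDiffOn hc₀ hτ
  have hd₀'c : ContinuousOn d₀' (Icc s t) := continuousOn_derivWithin_Icc_of_contDiffOn hd₀ hτ
  have hc₀'c : ContinuousOn c₀' (Icc s t) := continuousOn_derivWithin_Icc_of_contDiffOn hc₀ hτ
  have hρc : ∀ u ∈ Icc s t, ρ * c₀ u ≠ 0 := fun u hu => (mul_pos hρ (hcpos u hu)).ne'
  have hgc : ContinuousOn g (Icc s t) := hd₀c.div (continuousOn_const.mul hc₀c) hρc
  have hgd : ∀ u ∈ Ico s t, HasDerivWithinAt g (g' u) (Ici u) u := by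
    intro u hu
    have hu' : u ∈ Icc s t := Ico_subset_Icc_self hu
    have h1 := hasDerivWithinAt_Ici_of_contDiffOn hd₀ (hτ.trans hu.1)
    have h2 := (hasDerivWithinAt_Ici_of_contDiffOn hc₀ (hτ.trans hu.1)).const_mul ρ
    exact h1.div h2 (hρc u hu')
  have hg'c : ContinuousOn g' (Icc s t) :=
    ((hd₀'c.mul (continuousOn_const.mul hc₀c)).sub (hd₀c.mul (continuousOn_const.mul hc₀'c))).div
      ((continuousOn_const.mul hc₀c).pow 2) fun u hu => pow_ne_zero 2 (hρc u hu)
  -- FTC for `g`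
  have hFTC : ∫ u in s..t, g' u = g t - g s := by
    apply integral_eq_sub_of_hasDeriv_right_of_le hst hgc
    · intro u hu
      exact (hgd u ⟨hu.1.le, hu.2⟩).mono Ioi_subset_Ici_self
    · exact hg'c.intervalIntegrable_of_Icc hst
  -- the pointwise decomposition `a₀ = g' + R` with `|R| ≤ (ML + |κ|M² + η)/(ρ c_min)`
  have hR : ∀ u ∈ Icc s t, |a₀ u - g' u| ≤ (M * L + |κ| * M ^ 2 + η) / (ρ * c_min) := by
    intro u hu
    have hcu := hcpos u hu
    have hρcu : 0 < ρ * c₀ u := mul_pos hρ hcu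
    set e₄ := d₀' u - (ρ * c₀ u * a₀ u - κ * d₀ u * a₁ u) with he₄
    have key : a₀ u - g' u =
        (d₀ u * c₀' u / c₀ u + (κ * d₀ u * a₁ u - e₄)) / (ρ * c₀ u) := by
      simp only [hg', he₄]
      field_simp
      ring
    rw [key, abs_div, abs_of_pos hρcu, div_le_div_iff₀ hρcu (mul_pos hρ hcmin)]
    have t1 : |d₀ u * c₀' u / c₀ u| ≤ M * L := by
      rw [abs_div, abs_mul, abs_of_pos hcu, div_le_iff₀ hcu]
      calc |d₀ u| * |c₀' u| ≤ M * (L * c₀ u) :=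
            mul_le_mul (hdM u hu) (hc' u hu) (abs_nonneg _) hM0
        _ = M * L * c₀ u := by ring
    have t2 : |κ * d₀ u * a₁ u| ≤ |κ| * M ^ 2 := by
      rw [abs_mul, abs_mul]
      calc |κ| * |d₀ u| * |a₁ u| ≤ |κ| * M * M := by gcongr <;> [exact hdM u hu; exact haM u hu]
        _ = |κ| * M ^ 2 := by ring
    have t3 : |e₄| ≤ η := hD u hu
    have hsum : |d₀ u * c₀' u / c₀ u + (κ * d₀ u * a₁ u - e₄)| ≤ M * L + |κ| * M ^ 2 + η := by
      refine (abs_add_le _ _).trans ?_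
      have := abs_sub (κ * d₀ u * a₁ u) e₄
      linarith
    calc |d₀ u * c₀' u / c₀ u + (κ * d₀ u * a₁ u - e₄)| * (ρ * c_min)
        ≤ (M * L + |κ| * M ^ 2 + η) * (ρ * c_min) :=
          mul_le_mul_of_nonneg_right hsum (mul_pos hρ hcmin).le
      _ ≤ (M * L + |κ| * M ^ 2 + η) * (ρ * c₀ u) := by
          apply mul_le_mul_of_nonneg_left _ hL0
          exact mul_le_mul_of_nonneg_left (hc u hu) hρ.le
  -- bound on `g`
  have hgM : ∀ u ∈ Icc s t, |g u| ≤ M / (ρ * c_min) := by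
    intro u hu
    have hρcu : 0 < ρ * c₀ u := mul_pos hρ (hcpos u hu)
    simp only [hg]
    rw [abs_div, abs_of_pos hρcu, div_le_div_iff₀ hρcu (mul_pos hρ hcmin)]
    calc |d₀ u| * (ρ * c_min) ≤ M * (ρ * c_min) :=
          mul_le_mul_of_nonneg_right (hdM u hu) (mul_pos hρ hcmin).le
      _ ≤ M * (ρ * c₀ u) := by
          apply mul_le_mul_of_nonneg_left _ hM0
          exact mul_le_mul_of_nonneg_left (hc u hu) hρ.le
  -- assemble
  have hai : IntervalIntegrable a₀ volume s t := ha₀.intervalIntegrable_of_Icc hst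
  have hg'i : IntervalIntegrable g' volume s t := hg'c.intervalIntegrable_of_Icc hst
  have hsplit : ∫ u in s..t, a₀ u = (∫ u in s..t, g' u) + ∫ u in s..t, (a₀ u - g' u) := by
    rw [← integral_add hg'i (hai.sub hg'i)]
    congr 1; ext u; ring
  have hRint : |∫ u in s..t, (a₀ u - g' u)| ≤ (M * L + |κ| * M ^ 2 + η) / (ρ * c_min) * (t - s) := by
    have h := norm_integral_le_of_norm_le_const (a := s) (b := t) (f := fun u => a₀ u - g' u)
      (C := (M * L + |κ| * M ^ 2 + η) / (ρ * c_min)) ?_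
    · rw [abs_of_nonneg (sub_nonneg.2 hst)] at h
      simpa [Real.norm_eq_abs] using h
    · intro u hu
      rw [uIoc_of_le hst] at hu
      rw [Real.norm_eq_abs]
      exact hR u ⟨hu.1.le, hu.2⟩
  rw [hsplit, hFTC]
  calc |g t - g s + ∫ u in s..t, (a₀ u - g' u)|
      ≤ |g t - g s| + |∫ u in s..t, (a₀ u - g' u)| := abs_add_le _ _
    _ ≤ (|g t| + |g s|) + (M * L + |κ| * M ^ 2 + η) / (ρ * c_min) * (t - s) :=
        add_le_add (abs_sub _ _) hRint
    _ ≤ (M / (ρ * c_min) + M / (ρ * c_min)) + (M * L + |κ| * M ^ 2 + η) / (ρ * c_min) * (t - s) := by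
        gcongr
        · exact hgM t ⟨hst, le_rfl⟩
        · exact hgM s ⟨le_rfl, hst⟩
    _ = (2 * M + (M * L + |κ| * M ^ 2 + η) * (t - s)) / (ρ * c_min) := by
        field_simp; ring

end TaoCascade

end Literature.Analysis.FluidPDE
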